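import Summits.ABC.IUTFork.ForkGenuineDepthRankOne
import HarnessLib

/-!
# The fork at [IUTchIII] Corollary 3.12 at a GENUINE input: the COMPLETE CENSUS of the synthetic depth family over
# `F₀ = K = ℚ` (skeleton XXVIIe-b)

Record-only file (D-0012) of the abc-iut cell (deliverable (a), skeleton seat abc-iut-skel, gen 9); TAKES NO SIDE.
Companion of `ForkGenuineDepthRankOne.lean` (XXVIIe: over `ℚ/ℚ` every completion is a line, the packets carry no (Ind1)/(Ind2)/hull
inflation at ANY prime, and `Cor312Of (deepAt p l N σ) ↔ ((l+1)l/12 − 1)·N·log p ≤ ((l+5)/4)·log π`). HERE the right-hand side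
is decided from `3 < π < 3.15` (Mathlib `Real.pi_gt_three`, `Real.pi_lt_d2`) and `π < 4`:

* `not_cor312Of_deepAt_rat_of_ten_le` — for every `l ≥ 10`, every prime `p` and every depth `N ≥ 1` the typed inequality FAILS
  (`((l+1)l/12 − 1)·log 2 > ((l+5)/4)·log 4` iff `l² − 5l − 42 > 0`; only `π < 4` is used);
* `cor312Of_deepAt_rat_five_iff_pow` / `cor312Of_deepAt_rat_seven_iff_pow` — at `l = 5`, `7` the threshold reads `p^{3N} ≤ π^5`,
  `p^{11N} ≤ π^9`; `pi_pow_five_bounds` (`243 < π^5 < 311`), `pi_pow_nine_bounds` (`19683 < π^9 < 30600`);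
* **`cor312Of_deepAt_rat_five_iff`**: at `l = 5` TRUE iff `(p,N) ∈ {(2,1),(2,2),(3,1),(5,1)}`; **`cor312Of_deepAt_rat_seven_iff`**:
  at `l = 7` TRUE iff `(p,N) = (2,1)`;
* **`cor312Of_deepAt_rat_iff_census`** — for every section `σ`, prime `p`, prime `l ≥ 5`, depth `N ≥ 1`:
  `Cor312Of (deepAt p l N σ) ↔ (l,p,N) ∈ {(5,2,1),(5,2,2),(5,3,1),(5,5,1),(7,2,1)}` — FIVE inputs in the whole three-parameter family;
  the same census in reading (P) (`cor312PerImageOf_deepAt_rat_iff_census`, XXVIId-e); `exists_rat_inputs_both_sides` — both sides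
  of the typed inequality are inhabited over `ℚ/ℚ` (sections exist: `PlaceSection.nonempty`).

READING (grammar of `HOME/skel/FORK-REAL-MODEL.md` §4/§10, `FORK-INDEX.md` row 2 "at a glance"; no side taken): the fully numeric
column of the row-2 table — with no ramification and no inflation anywhere, the typed [IUTchIII] Cor. 3.12 along the family is the
free gap `((l+1)l/12 − 1)·N·log p` against the archimedean term `((l+5)/4)·log π`, a finite list. HONEST SCOPE: synthetic inhabitants
of abc-iut-S2's INPUT TYPE over `ℚ/ℚ` (genuine completions `ℚ_p`, synthetic ideles), NOT initial Θ-data of [IUTchI] Def. 3.1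
(`√−1 ∈ F ⊆ K`, Def. 3.1 (a): `K` is never `ℚ`). Nothing here bears on whether [IUTchIII] Thm. 3.11 licenses Cor. 3.12; typed ≠ proved.
PROOF-ONLY file: no definitions, no `Prop` facts.
[cite: Mochizuki2012, IUTchIII Cor. 3.12 p. 173–174] [cite: Mochizuki2012, IUTchIV Thm. 1.10 Steps (vi)–(vii) p. 29–30]
[cite: DupuyHilado2025, §1 (1.1), Def. 3.6.3, §3.9] [claim: Mochizuki2012, status: disputed]
-/

noncomputable section

open Set Module Literature.IUT.LogVolume Literature.NumberTheory.NumberFields NumberField IsDedekindDomain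
open scoped Pointwise

namespace Summit.ABC.IUTFork.GenuineContent

section RatCensus

variable (p : ℕ) [hp : Fact p.Prime] (l : ℕ) (hl : l.Prime) (h5 : 5 ≤ l) (σ : PlaceSection ℚ ℚ)

/-! ## The census: `3 < π < 3.15` decides every case -/

/-- **For `l ≥ 10` the typed inequality FAILS over `ℚ/ℚ` at every prime and every depth** (only `π < 4` is used:
`((l+1)l/12 − 1)·log 2 > ((l+5)/4)·log 4` iff `l² − 5l − 42 > 0`). [cite: Mochizuki2012, IUTchIII Cor. 3.12 p. 173–174]
[claim: Mochizuki2012, status: disputed] -/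
theorem not_cor312Of_deepAt_rat_of_ten_le (h10 : 10 ≤ l) (N : ℕ) (hN : 0 < N) :
    ¬ (ThetaVolumeInput.deepAt p l hl h5 N hN σ).Cor312Of := by
  rw [cor312Of_deepAt_rat_iff, not_le]
  unfold ThetaVolumeInput.archLogTheta
  have hlog2pos : 0 < Real.log 2 := Real.log_pos one_lt_two
  have hlog2 : Real.log 2 ≤ (N : ℝ) * Real.log p := by
    have h1 : Real.log 2 ≤ Real.log p :=
      Real.log_le_log two_pos (by exact_mod_cast hp.out.two_le)
    have h2 : (1 : ℝ) ≤ N := by exact_mod_cast hN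
    nlinarith
  have hlogπ : Real.log Real.pi < 2 * Real.log 2 := by
    have h4 : Real.log Real.pi < Real.log 4 := Real.log_lt_log Real.pi_pos Real.pi_lt_four
    have h22 : Real.log 4 = 2 * Real.log 2 := by
      rw [show (4 : ℝ) = 2 ^ 2 by norm_num, Real.log_pow]
      norm_num
    linarith
  have hl10 : (10 : ℝ) ≤ l := by exact_mod_cast h10
  have hcoef : ((l : ℝ) + 5) / 2 < ((l : ℝ) + 1) * l / 12 - 1 := by nlinarith
  have hslope : 0 < ((l : ℝ) + 1) * l / 12 - 1 := by nlinarith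
  calc ((l : ℝ) + 5) / 4 * Real.log Real.pi
      < ((l : ℝ) + 5) / 4 * (2 * Real.log 2) := mul_lt_mul_of_pos_left hlogπ (by positivity)
    _ = ((l : ℝ) + 5) / 2 * Real.log 2 := by ring
    _ < (((l : ℝ) + 1) * l / 12 - 1) * Real.log 2 := mul_lt_mul_of_pos_right hcoef hlog2pos
    _ ≤ (((l : ℝ) + 1) * l / 12 - 1) * ((N : ℝ) * Real.log p) := mul_le_mul_of_nonneg_left hlog2 hslope.le

/-- `243 < π^5 < 311`. [folklore] -/
theorem pi_pow_five_bounds : (243 : ℝ) < Real.pi ^ 5 ∧ Real.pi ^ 5 < 311 := by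
  constructor
  · have h := pow_lt_pow_left₀ Real.pi_gt_three (by norm_num) (n := 5) (by norm_num)
    norm_num at h
    exact h
  · have h := pow_lt_pow_left₀ Real.pi_lt_d2 Real.pi_pos.le (n := 5) (by norm_num)
    have h2 : (3.15 : ℝ) ^ 5 < 311 := by norm_num
    exact h.trans h2

/-- `19683 < π^9 < 30600`. [folklore] -/
theorem pi_pow_nine_bounds : (19683 : ℝ) < Real.pi ^ 9 ∧ Real.pi ^ 9 < 30600 := by
  constructor
  · have h := pow_lt_pow_left₀ Real.pi_gt_three (by norm_num) (n := 9) (by norm_num)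
    norm_num at h
    exact h
  · have h := pow_lt_pow_left₀ Real.pi_lt_d2 Real.pi_pos.le (n := 9) (by norm_num)
    have h2 : (3.15 : ℝ) ^ 9 < 30600 := by norm_num
    exact h.trans h2

/-- At `l = 5` the threshold reads `p^{3N} ≤ π^5` (slope `3/2`, budget `(5/2)·log π`). [cite: Mochizuki2012, IUTchIV Thm. 1.10 Step (vii) p. 30]
[claim: Mochizuki2012, status: disputed] -/
theorem cor312Of_deepAt_rat_five_iff_pow (N : ℕ) (hN : 0 < N) :
    (ThetaVolumeInput.deepAt p 5 Nat.prime_five le_rfl N hN σ).Cor312Of ↔ (p : ℝ) ^ (3 * N) ≤ Real.pi ^ 5 := by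
  rw [cor312Of_deepAt_rat_iff]
  unfold ThetaVolumeInput.archLogTheta
  have hp0 : (0 : ℝ) < p := by exact_mod_cast hp.out.pos
  rw [← Real.log_le_log_iff (pow_pos hp0 _) (pow_pos Real.pi_pos _), Real.log_pow, Real.log_pow]
  push_cast
  constructor <;> intro h <;> linarith

/-- At `l = 7` the threshold reads `p^{11N} ≤ π^9` (slope `11/3`, budget `3·log π`). [cite: Mochizuki2012, IUTchIV Thm. 1.10 Step (vii) p. 30]
[claim: Mochizuki2012, status: disputed] -/
theorem cor312Of_deepAt_rat_seven_iff_pow (N : ℕ) (hN : 0 < N) :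
    (ThetaVolumeInput.deepAt p 7 Nat.prime_seven (by norm_num) N hN σ).Cor312Of ↔ (p : ℝ) ^ (11 * N) ≤ Real.pi ^ 9 := by
  rw [cor312Of_deepAt_rat_iff]
  unfold ThetaVolumeInput.archLogTheta
  have hp0 : (0 : ℝ) < p := by exact_mod_cast hp.out.pos
  rw [← Real.log_le_log_iff (pow_pos hp0 _) (pow_pos Real.pi_pos _), Real.log_pow, Real.log_pow]
  push_cast
  constructor <;> intro h <;> linarith

/-- **CENSUS AT `l = 5` over `ℚ/ℚ`**: the typed inequality holds iff `(p, N) ∈ {(2,1), (2,2), (3,1), (5,1)}`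
(`p^{3N} ≤ π^5 ∈ (243, 311)`: `8, 64, 27, 125` pass; `512, 729, 15625, 343, …` fail).
[cite: Mochizuki2012, IUTchIII Cor. 3.12 p. 173–174] [claim: Mochizuki2012, status: disputed] -/
theorem cor312Of_deepAt_rat_five_iff (N : ℕ) (hN : 0 < N) :
    (ThetaVolumeInput.deepAt p 5 Nat.prime_five le_rfl N hN σ).Cor312Of ↔
      (p = 2 ∧ N ≤ 2) ∨ (p = 3 ∧ N = 1) ∨ (p = 5 ∧ N = 1) := by
  rw [cor312Of_deepAt_rat_five_iff_pow]
  obtain ⟨hlo, hhi⟩ := pi_pow_five_bounds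
  constructor
  · intro h
    have hlt : ((p ^ (3 * N) : ℕ) : ℝ) < 311 := by push_cast; linarith
    have hnat : p ^ (3 * N) < 311 := by exact_mod_cast hlt
    have hp2 := hp.out.two_le
    have hp7 : p < 7 := by
      by_contra hge
      push Not at hge
      have h3 : 7 ^ 3 ≤ p ^ (3 * N) :=
        le_trans (Nat.pow_le_pow_left hge 3) (Nat.pow_le_pow_right hp.out.pos (by omega))
      omega
    interval_cases p
    · -- p = 2
      left
      refine ⟨rfl, ?_⟩
      by_contra hN3
      push Not at hN3
      have h3 : 2 ^ 9 ≤ 2 ^ (3 * N) := Nat.pow_le_pow_right (by norm_num) (by omega)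
      omega
    · -- p = 3
      right; left
      refine ⟨rfl, ?_⟩
      by_contra hN2
      have h3 : 3 ^ 6 ≤ 3 ^ (3 * N) := Nat.pow_le_pow_right (by norm_num) (by omega)
      omega
    · exact absurd hp.out (by norm_num)
    · -- p = 5
      right; right
      refine ⟨rfl, ?_⟩
      by_contra hN2
      have h3 : 5 ^ 6 ≤ 5 ^ (3 * N) := Nat.pow_le_pow_right (by norm_num) (by omega)
      omega
    · exact absurd hp.out (by norm_num)
  · rintro (⟨rfl, hN2⟩ | ⟨rfl, rfl⟩ | ⟨rfl, rfl⟩)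
    · calc ((2 : ℕ) : ℝ) ^ (3 * N) ≤ ((2 : ℕ) : ℝ) ^ 6 := pow_le_pow_right₀ (by norm_num) (by omega)
        _ ≤ Real.pi ^ 5 := by norm_num; linarith
    · norm_num; linarith
    · norm_num; linarith

/-- **CENSUS AT `l = 7` over `ℚ/ℚ`**: the typed inequality holds iff `(p, N) = (2, 1)` (`p^{11N} ≤ π^9 ∈ (19683, 30600)`:
`2048` passes; `2^22, 3^11 = 177147, …` fail). [cite: Mochizuki2012, IUTchIII Cor. 3.12 p. 173–174] [claim: Mochizuki2012, status: disputed] -/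
theorem cor312Of_deepAt_rat_seven_iff (N : ℕ) (hN : 0 < N) :
    (ThetaVolumeInput.deepAt p 7 Nat.prime_seven (by norm_num) N hN σ).Cor312Of ↔ p = 2 ∧ N = 1 := by
  rw [cor312Of_deepAt_rat_seven_iff_pow]
  obtain ⟨hlo, hhi⟩ := pi_pow_nine_bounds
  constructor
  · intro h
    have hlt : ((p ^ (11 * N) : ℕ) : ℝ) < 30600 := by push_cast; linarith
    have hnat : p ^ (11 * N) < 30600 := by exact_mod_cast hlt
    have hp2 := hp.out.two_le
    have hp3 : p < 3 := by
      by_contra hge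
      push Not at hge
      have h3 : 3 ^ 11 ≤ p ^ (11 * N) :=
        le_trans (Nat.pow_le_pow_left hge 11) (Nat.pow_le_pow_right hp.out.pos (by omega))
      omega
    interval_cases p
    refine ⟨rfl, ?_⟩
    by_contra hN2
    have h3 : 2 ^ 22 ≤ 2 ^ (11 * N) := Nat.pow_le_pow_right (by norm_num) (by omega)
    omega
  · rintro ⟨rfl, rfl⟩
    norm_num; linarith

include hl h5 in
/-- A prime `l ≥ 5` below `10` is `5` or `7`. [folklore] -/
theorem eq_five_or_seven_of_lt_ten (h10 : l < 10) : l = 5 ∨ l = 7 := by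
  interval_cases l
  · exact Or.inl rfl
  · exact absurd hl (by norm_num)
  · exact Or.inr rfl
  · exact absurd hl (by norm_num)
  · exact absurd hl (by norm_num)

/-- **THE COMPLETE CENSUS OVER `ℚ/ℚ`.** For every section `σ`, every prime `p`, every prime `l ≥ 5` and every depth `N ≥ 1`, the typed
inequality of [IUTchIII] Cor. 3.12 for the synthetic input `deepAt p l N σ` over `F₀ = K = ℚ` holds if and only if
`(l, p, N) ∈ {(5,2,1), (5,2,2), (5,3,1), (5,5,1), (7,2,1)}` — five inputs in the whole three-parameter family. HYPOTHESIS-shaped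
statement about OUR typed number at synthetic inputs; no side taken. [cite: Mochizuki2012, IUTchIII Cor. 3.12 p. 173–174]
[cite: Mochizuki2012, IUTchIV Thm. 1.10 Steps (vi)–(vii) p. 29–30] [claim: Mochizuki2012, status: disputed] -/
theorem cor312Of_deepAt_rat_iff_census (N : ℕ) (hN : 0 < N) :
    (ThetaVolumeInput.deepAt p l hl h5 N hN σ).Cor312Of ↔
      (l = 5 ∧ ((p = 2 ∧ N ≤ 2) ∨ (p = 3 ∧ N = 1) ∨ (p = 5 ∧ N = 1))) ∨ (l = 7 ∧ p = 2 ∧ N = 1) := by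
  by_cases h10 : 10 ≤ l
  · have hnot := not_cor312Of_deepAt_rat_of_ten_le p l hl h5 σ h10 N hN
    constructor
    · exact fun h => absurd h hnot
    · rintro (⟨rfl, _⟩ | ⟨rfl, _⟩) <;> omega
  · rcases eq_five_or_seven_of_lt_ten l hl h5 (not_le.mp h10) with rfl | rfl
    · rw [cor312Of_deepAt_rat_five_iff]
      constructor
      · exact fun h => Or.inl ⟨rfl, h⟩
      · rintro (⟨_, h⟩ | ⟨h7, _⟩)
        · exact h
        · omega
    · rw [cor312Of_deepAt_rat_seven_iff]
      constructor
      · exact fun h => Or.inr ⟨rfl, h⟩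
      · rintro (⟨h5', _⟩ | ⟨_, h⟩)
        · omega
        · exact h

/-- The same census in reading (P) (the readings coincide on the slot-constant family, XXVIId-e).
[cite: Mochizuki2012, IUTchIII Cor. 3.12 p. 173–174] [claim: Mochizuki2012, status: disputed] -/
theorem cor312PerImageOf_deepAt_rat_iff_census (N : ℕ) (hN : 0 < N) :
    (ThetaVolumeInput.deepAt p l hl h5 N hN σ).Cor312PerImageOf ↔
      (l = 5 ∧ ((p = 2 ∧ N ≤ 2) ∨ (p = 3 ∧ N = 1) ∨ (p = 5 ∧ N = 1))) ∨ (l = 7 ∧ p = 2 ∧ N = 1) := by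
  rw [cor312PerImageOf_deepAt_iff_cor312Of, cor312Of_deepAt_rat_iff_census]

/-- **Both sides are inhabited over `ℚ/ℚ`, explicitly**: with `σ` any section (sections exist, `PlaceSection.nonempty`), the typed
inequality HOLDS for `deepAt 2 5 1 σ` and FAILS for `deepAt 2 5 3 σ`. [cite: Mochizuki2012, IUTchIII Cor. 3.12 p. 173–174]
[claim: Mochizuki2012, status: disputed] -/
theorem exists_rat_inputs_both_sides :
    ∃ I J : ThetaVolumeInput ℚ ℚ, I.Cor312Of ∧ ¬ J.Cor312Of := by
  obtain ⟨σ⟩ := PlaceSection.nonempty ℚ ℚ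
  haveI : Fact (Nat.Prime 2) := ⟨Nat.prime_two⟩
  refine ⟨ThetaVolumeInput.deepAt 2 5 Nat.prime_five le_rfl 1 Nat.one_pos σ,
    ThetaVolumeInput.deepAt 2 5 Nat.prime_five le_rfl 3 (by norm_num) σ, ?_, ?_⟩
  · exact (cor312Of_deepAt_rat_five_iff 2 σ 1 Nat.one_pos).mpr (Or.inl ⟨rfl, by norm_num⟩)
  · intro h
    rcases (cor312Of_deepAt_rat_five_iff 2 σ 3 (by norm_num)).mp h with ⟨_, h⟩ | ⟨h, _⟩ | ⟨h, _⟩ <;> omega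

end RatCensus

end Summit.ABC.IUTFork.GenuineContent

end
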